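import Literature.NumberTheory.EllipticCurves.ModularSymbolsParabolicCohomology
import Literature.NumberTheory.EllipticCurves.ModularSymbolsManin
import Literature.NumberTheory.EllipticCurves.ModularFormsGamma0Genus
import Mathlib.LinearAlgebra.Trace
import Mathlib.LinearAlgebra.FiniteDimensional.Lemmas
import HarnessLib

/-!
# Shimura's dimension count `dim_ℝ H¹_P(Γ₀(N), ℝ) = 2 dim_ℂ S₂(Γ₀(N))`: discharge of
# `finrank_parabolicCocycles_eq` (`ModularSymbolsParabolicCohomology`, continued)

`ModularSymbolsParabolicCohomology` defines the parabolic cohomology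
`H¹_P(Γ₀(N), ℝ) = Z¹_P(Γ₀(N), ℝ)` (`parabolicCocycles N`: homomorphisms `u : Γ₀(N) → ℝ` killing
the parabolic elements), proves the injectivity half
`2 dim_ℂ S₂(Γ₀(N)) ≤ dim_ℝ H¹_P(Γ₀(N), ℝ)` of the Eichler–Shimura isomorphism (Shimura 1971,
Thm. 8.4) and states Shimura's dimension count (8.2.23),
`dim_ℝ H¹_P(Γ₀(N), ℝ) = 2 dim_ℂ S₂(Γ₀(N))`, as the named fact `finrank_parabolicCocycles_eq N`.
This file proves it for every `N : ℕ` (`finrank_parabolicCocycles_eq_holds`).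

Shimura's proof ((8.2.24), from Prop. 8.1–8.3: group cohomology is isogenous to the cohomology of
a `Γ`-stable simplicial decomposition `K` of `ℍ` minus cusp neighbourhoods, whose Euler
characteristic is counted on a fundamental domain) gives `dim H¹_P(Γ, ℝ) = 2g`, `g` the genus of
`Γ\ℍ*`, and then invokes `dim S₂(Γ) = g` (Thm. 2.24). Here the missing inequality
`dim_ℝ H¹_P(Γ₀(N), ℝ) ≤ 2g(X₀(N))` is proved by the same Euler-characteristic count organised
group-theoretically, with the combinatorial genus `12g = 12 + μ - 3ε₂ - 4ε₃ - 6ε_∞` of the tree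
(`μ = [SL(2, ℤ) : Γ₀(N)]`, `ε₂ = #{x ∈ X : Sx = x}`, `ε₃ = #{x : TSx = x}`, `ε_∞ = #(⟨T⟩\X)` on
`X = SL(2, ℤ)/Γ₀(N)`), and `g(X₀(N)) = dim S₂(Γ₀(N))` is the tree's theorem
`twelve_mul_finrank_cuspForm_two_gamma0_holds` (`ModularFormsGamma0Genus`):

* **Shapiro's lemma, explicitly** (`ParabolicCount.lift`): with a section `s` of
  `SL(2, ℤ) → X`, a homomorphism `u : Γ₀(N) → ℝ` gives the `1`-cocycle
  `E_u(g)(x) = u(s(gx)⁻¹ g s(x))` of `SL(2, ℤ)` with values in `ℝ^X = Coind(ℝ)`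
  (`E(gh) = h^*E(g) + E(h)`, `lift_mul`), with `E_u(γ)(Γ₀(N)) = u(γ)` (`lift_apply_coe_one`);
  coboundaries `δf(g) = g^*f - f` (`cobd`) restrict to `0` (`cobd_apply_coe_one`).
* **The cocycle is determined by `E(S), E(T) ∈ ℝ^X`** (`SL(2, ℤ) = ⟨S, T⟩`, Mathlib
  `SL2Z_generators`; `tot_eq_zero_of_S_T`), and these satisfy (`range_lam_le`)
  `(1 + S^*)E(S) = E(S²) = E(-1) = 0`, `(1 + U + U²)(T^*E(S) + E(T)) = (1 + U + U²)E(ST) =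
  E((ST)³) = E(-1) = 0` (`U = (ST)^*`), and — the parabolic condition — **the sum of `E(T)` over
  every `⟨T⟩`-orbit (= cusp) vanishes** (`∑_{i<w} E(T)(Tⁱx) = E(T^w)(x) = u(s(x)⁻¹ T^w s(x)) = 0`
  for `T^w x = x`: `s(x)⁻¹T^ws(x)` is a parabolic element of `Γ₀(N)`; `cuspSum_lift_T`).
* **Counting** (`six_mul_finrank_parabolicCocycles_le`): `u ⊕ f ↦ (E_u + δf)(S), (E_u + δf)(T)`
  is injective modulo the constants `f` (`finrank_ker_lam_le_one`), so
  `dim H¹_P + μ - 1 ≤ dim W` for the solution space `W` of the three linear conditions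
  (`solSpace`), and `dim W ≤ (μ - rk(1 + S^*)) + dim(ker(1 + U + U²) ∩ ker(orbit sums))`
  (`finrank_solSpace_le`) with
  `2 rk(1 + S^*) = μ + ε₂`, `3 rk(1 + U + U²) = μ + 2#{x : STx = x} = μ + 2ε₃` (traces of the
  projections onto invariants, as in `ModularSymbolsManin`; `card_fixed_TS_eq_card_fixed_ST`),
  `rk(orbit sums) = ε_∞` (`finrank_range_cuspSum`, `card_basePoints`), and
  `ker(1 + U + U²) + ker(orbit sums) ⊇ ⟨e_x - e_y⟩` of codimension `1` (it contains `Pf - f` for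
  `P = (ST)^*, T^*`, hence for `P = g^*`, all `g ∈ SL(2, ℤ)`, which is transitive on `X`;
  `card_le_finrank_ker_sup_add_one`). Altogether
  **`6 dim_ℝ H¹_P(Γ₀(N), ℝ) + 3ε₂ + 4ε₃ + 6ε_∞ ≤ 12 + μ`**, i.e. `dim H¹_P ≤ 2g(X₀(N))` — the
  inequality half of Shimura's (8.2.24) for `n = 0` (where `η_k = 0`, `ξ_j = ζ = ζ' = 1`).
* `finrank_parabolicCocycles_le_two_mul_finrank` (`N ≥ 1`): with
  `12 dim S₂(Γ₀(N)) + 3ε₂ + 4ε₃ + 6ε_∞ = 12 + μ` (`twelve_mul_finrank_cuspForm_two_gamma0_holds`,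
  `ellipticPointCount_two_gamma0_eq_card`, `ellipticPointCount_three_gamma0_eq_card`) the count is
  `dim H¹_P ≤ 2 dim S₂`; the reverse inequality is `two_mul_finrank_le_finrank_parabolicCocycles`.
* `LevelZero`: the named fact is registered for every `N : ℕ` (no `NeZero N` hypothesis), and at
  the degenerate level `N = 0` — `Γ₀(0) = {±Tʲ}`, of infinite index and not a Fuchsian group of the
  first kind, so outside Shimura's hypotheses — both sides vanish: `H¹_P(Γ₀(0), ℝ) = 0`
  (`parabolicCocycles_zero_eq_bot`: every element is `±1` or parabolic) and
  `finrank ℂ S₂(Γ₀(0)) = 0` (`finrank_cuspForm_gamma0_zero`: the cusp forms `q^{m+1}`,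
  `qPowCuspForm`, are linearly independent, so `S₂(Γ₀(0))` is not finite-dimensional and Lean's
  `finrank` is `0`).
* `finrank_parabolicCocycles_eq_holds : finrank_parabolicCocycles_eq N` (every `N : ℕ`): the
  literal discharge, by cases `N = 0` / `N ≥ 1`.

## References

* G. Shimura, *Introduction to the arithmetic theory of automorphic functions*, Iwanami Shoten and
  Princeton University Press, 1971: §8.1 ((8.1.1)–(8.1.4), Prop. 8.1, Prop. 8.2, Prop. 8.3,
  (8.1.30)), §8.2 (Thm. 8.4, (8.2.23), (8.2.24), p. 236: "Suppose first that `n = 0`. Then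
  `η_k = 0`, and `ξ_j = ζ = ζ' = 1`, hence `dim (H¹_P(Γ, X)) = 2g`").
* J. E. Cremona, *Algorithms for modular elliptic curves*, 2nd ed., CUP 1997, §2.1–2.2 (M-symbols,
  the relation operators `1 + S`, `1 + TS + (TS)²`, cusps as `⟨T⟩`-orbits on `ℙ¹(ℤ/Nℤ)`).
* K. S. Brown, *Cohomology of groups*, GTM 87, Springer 1982, III.6 (Shapiro's lemma, Prop. 6.2).
-/

noncomputable section

open scoped MatrixGroups ModularForm

open CongruenceSubgroup Matrix.SpecialLinearGroup ModularGroup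

namespace Literature.NumberTheory.EllipticCurves.ModularForms

namespace ParabolicCount

open _root_.Module _root_.LinearMap
open scoped Classical

variable {N : ℕ}

/-! ### The permutation representation `ℝ^X`, `X = SL(2, ℤ)/Γ₀(N)` -/

/-- The permutation action of `g ∈ SL(2, ℤ)` on `ℝ^X`: `(g^* f)(x) = f(g x)`. [folklore] -/
def coperm (g : SL(2, ℤ)) : (Gamma0Coset N → ℝ) →ₗ[ℝ] (Gamma0Coset N → ℝ) :=
  LinearMap.funLeft ℝ ℝ (g • ·)

/-- Unfolding `coperm`. [folklore] -/
@[simp] theorem coperm_apply (g : SL(2, ℤ)) (f : Gamma0Coset N → ℝ) (x : Gamma0Coset N) :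
    coperm g f x = f (g • x) := rfl

/-- `(gh)^* = h^* ∘ g^*`. [folklore] -/
theorem coperm_mul (g h : SL(2, ℤ)) : coperm (N := N) (g * h) = coperm h ∘ₗ coperm g := by
  apply LinearMap.ext
  intro f
  funext x
  simp [mul_smul]

/-- `1^* = 1`. [folklore] -/
theorem coperm_one : coperm (N := N) 1 = LinearMap.id := by
  apply LinearMap.ext
  intro f
  funext x
  simp

/-- `(-g)^* = g^*` (`-1 ∈ Γ₀(N)` acts trivially on the cosets). [folklore] -/
theorem coperm_neg (g : SL(2, ℤ)) : coperm (N := N) (-g) = coperm g := by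
  apply LinearMap.ext
  intro f
  funext x
  simp [neg_smul_coset]

/-- `(-1)^* = 1`. [folklore] -/
theorem coperm_neg_one : coperm (N := N) (-1) = LinearMap.id := by
  rw [coperm_neg, coperm_one]

/-- `g^* ∘ (g⁻¹)^* = 1`. [folklore] -/
theorem coperm_comp_coperm_inv (g : SL(2, ℤ)) : coperm (N := N) g ∘ₗ coperm g⁻¹ = LinearMap.id := by
  rw [← coperm_mul, inv_mul_cancel, coperm_one]

/-- `(g⁻¹)^* ∘ g^* = 1`. [folklore] -/
theorem coperm_inv_comp_coperm (g : SL(2, ℤ)) : coperm (N := N) g⁻¹ ∘ₗ coperm g = LinearMap.id := by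
  rw [← coperm_mul, mul_inv_cancel, coperm_one]

/-- `g^* (g⁻¹)^* f = f`. [folklore] -/
@[simp] theorem coperm_coperm_inv (g : SL(2, ℤ)) (f : Gamma0Coset N → ℝ) :
    coperm g (coperm g⁻¹ f) = f := by
  have := congrArg (fun φ ↦ φ f) (coperm_comp_coperm_inv (N := N) g)
  simpa using this

/-- `(g⁻¹)^* g^* f = f`. [folklore] -/
@[simp] theorem coperm_inv_coperm (g : SL(2, ℤ)) (f : Gamma0Coset N → ℝ) :
    coperm g⁻¹ (coperm g f) = f := by
  have := congrArg (fun φ ↦ φ f) (coperm_inv_comp_coperm (N := N) g)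
  simpa using this

/-- `g^* e_x = e_{g⁻¹x}`. [folklore] -/
theorem coperm_single (g : SL(2, ℤ)) (x : Gamma0Coset N) (a : ℝ) :
    coperm g (Pi.single x a) = Pi.single (g⁻¹ • x) a := by
  funext y
  simp only [coperm_apply, Pi.single_apply, eq_inv_smul_iff]

/-- `S^* ∘ S^* = 1`. [folklore] -/
theorem coperm_S_comp_S : coperm (N := N) S ∘ₗ coperm S = LinearMap.id := by
  rw [← coperm_mul, S_mul_S_eq_neg_one, coperm_neg_one]

/-- `(ST)³ = -1` in `SL(2, ℤ)`. [folklore] -/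
theorem ST_pow_three_eq : S * T * (S * T) * (S * T) = -1 := by
  ext i j
  fin_cases i <;> fin_cases j <;> simp [coe_S, coe_T, Matrix.mul_apply, Fin.sum_univ_two]

/-- `(ST)²x = x ↔ STx = x` on cosets (`(ST)³` acts trivially). [folklore] -/
theorem ST_smul_iff (q : Gamma0Coset N) : (S * T) • (S * T) • q = q ↔ (S * T) • q = q := by
  have h3 : (S * T) • (S * T) • (S * T) • q = q := by
    rw [← mul_smul, ← mul_smul, ST_pow_three_eq, neg_one_smul_coset]
  constructor
  · intro h
    rw [show (S * T) • q = (S * T) • (S * T) • (S * T) • q by rw [h]]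
    exact h3
  · intro h
    rw [h, h]

/-- `((ST)^*)³ = 1`. [folklore] -/
theorem coperm_ST_comp_ST_comp_ST :
    coperm (N := N) (S * T) ∘ₗ (coperm (S * T) ∘ₗ coperm (S * T)) = LinearMap.id := by
  rw [← coperm_mul, ← coperm_mul, ST_pow_three_eq, coperm_neg_one]

variable [NeZero N]

/-- **The trace of a permutation matrix is its number of fixed points.** [folklore] -/
theorem trace_coperm (g : SL(2, ℤ)) :
    LinearMap.trace ℝ _ (coperm (N := N) g) =
      ((Finset.univ.filter fun x : Gamma0Coset N ↦ g • x = x).card : ℝ) := by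
  rw [LinearMap.trace_eq_matrix_trace ℝ (Pi.basisFun ℝ (Gamma0Coset N)), Matrix.trace]
  simp only [Matrix.diag, LinearMap.toMatrix_apply, Pi.basisFun_repr, coperm_apply,
    Pi.basisFun_apply, Pi.single_apply]
  rw [Finset.card_filter]
  push_cast
  rfl

/-- If `A² = k A` with `k ≠ 0` then `A/k` is the projection onto `range A`, so
`trace A = k · dim range A`. [folklore] -/
theorem trace_eq_mul_finrank_range {V : Type*} [AddCommGroup V] [Module ℝ V]
    [FiniteDimensional ℝ V] (A : V →ₗ[ℝ] V) {k : ℝ} (hk : k ≠ 0) (hA : A ∘ₗ A = k • A) :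
    LinearMap.trace ℝ V A = k * finrank ℝ (range A) := by
  set P : V →ₗ[ℝ] V := k⁻¹ • A with hP
  have hPidem : IsIdempotentElem P := by
    change P * P = P
    rw [hP, smul_mul_smul_comm, Module.End.mul_eq_comp, hA, smul_smul, mul_assoc,
      inv_mul_cancel₀ hk, mul_one]
  have hrange : range P = range A := LinearMap.range_smul A k⁻¹ (inv_ne_zero hk)
  have htr := (LinearMap.IsIdempotentElem.isProj_range P hPidem).trace
  have hAP : LinearMap.trace ℝ V A = k * LinearMap.trace ℝ V P := by
    rw [hP, _root_.map_smul, smul_eq_mul, ← mul_assoc, mul_inv_cancel₀ hk, one_mul]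
  rw [hAP, htr, hrange]

variable (N)

/-- The operator `1 + S^*` on `ℝ^X` (twice the projection onto the `S^*`-invariants). [folklore] -/
def relS : (Gamma0Coset N → ℝ) →ₗ[ℝ] (Gamma0Coset N → ℝ) := LinearMap.id + coperm S

/-- The operator `1 + (ST)^* + (ST)^{*2}` on `ℝ^X` (three times the projection onto the
`(ST)^*`-invariants). [folklore] -/
def relST : (Gamma0Coset N → ℝ) →ₗ[ℝ] (Gamma0Coset N → ℝ) :=
  LinearMap.id + coperm (S * T) + coperm (S * T) ∘ₗ coperm (S * T)

variable {N}

omit [NeZero N] in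
/-- `(1 + S^*)² = 2(1 + S^*)`. [folklore] -/
theorem relS_comp_relS : relS N ∘ₗ relS N = (2 : ℝ) • relS N := by
  rw [show (2 : ℝ) = ((2 : ℕ) : ℝ) by norm_num, Nat.cast_smul_eq_nsmul]
  simp only [relS, LinearMap.add_comp, LinearMap.comp_add, LinearMap.id_comp, LinearMap.comp_id,
    coperm_S_comp_S]
  abel

omit [NeZero N] in
/-- `(1 + (ST)^* + (ST)^{*2})² = 3(1 + (ST)^* + (ST)^{*2})`. [folklore] -/
theorem relST_comp_relST : relST N ∘ₗ relST N = (3 : ℝ) • relST N := by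
  rw [show (3 : ℝ) = ((3 : ℕ) : ℝ) by norm_num, Nat.cast_smul_eq_nsmul]
  have h3 := coperm_ST_comp_ST_comp_ST (N := N)
  simp only [relST, LinearMap.add_comp, LinearMap.comp_add, LinearMap.id_comp, LinearMap.comp_id,
    LinearMap.comp_assoc, h3]
  abel

/-- `2 dim range(1 + S^*) = μ + ε₂` with `ε₂ = #{x : Sx = x}`. [folklore] -/
theorem two_mul_finrank_range_relS :
    2 * finrank ℝ (range (relS N)) =
      Fintype.card (Gamma0Coset N) + (Finset.univ.filter fun q : Gamma0Coset N ↦ S • q = q).card := by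
  have h := trace_eq_mul_finrank_range (relS N) two_ne_zero relS_comp_relS
  have htr : LinearMap.trace ℝ _ (relS N) =
      (Fintype.card (Gamma0Coset N) : ℝ) +
        (Finset.univ.filter fun q : Gamma0Coset N ↦ S • q = q).card := by
    rw [relS, map_add, LinearMap.trace_id, finrank_fintype_fun_eq_card, trace_coperm]
  rw [htr] at h
  exact_mod_cast h.symm

/-- `3 dim range(1 + (ST)^* + (ST)^{*2}) = μ + 2ε₃` with `ε₃ = #{x : STx = x}`. [folklore] -/
theorem three_mul_finrank_range_relST :
    3 * finrank ℝ (range (relST N)) =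
      Fintype.card (Gamma0Coset N) +
        2 * (Finset.univ.filter fun q : Gamma0Coset N ↦ (S * T) • q = q).card := by
  have h := trace_eq_mul_finrank_range (relST N) three_ne_zero relST_comp_relST
  have h2 : coperm (N := N) (S * T) ∘ₗ coperm (S * T) = coperm ((S * T) * (S * T)) :=
    (coperm_mul _ _).symm
  have hfix : (Finset.univ.filter fun q : Gamma0Coset N ↦ ((S * T) * (S * T)) • q = q) =
      Finset.univ.filter fun q : Gamma0Coset N ↦ (S * T) • q = q :=
    Finset.filter_congr fun q _ ↦ by rw [mul_smul]; exact ST_smul_iff q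
  have htr : LinearMap.trace ℝ _ (relST N) = (Fintype.card (Gamma0Coset N) : ℝ) +
      2 * (Finset.univ.filter fun q : Gamma0Coset N ↦ (S * T) • q = q).card := by
    rw [relST, map_add, map_add, LinearMap.trace_id, finrank_fintype_fun_eq_card, h2, trace_coperm,
      trace_coperm, hfix]
    ring
  rw [htr] at h
  exact_mod_cast h.symm

/-! ### The cusp sums: `b ↦ (∑_{x ∈ orbit} b(x))_{orbits of T}` -/

variable (N) in
/-- The **cusp-sum map** `ℝ^X → ℝ^{cusps}`: `b ↦ (∑_{y ∈ ⟨T⟩x} b(y))_x`, indexed by the base points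
`x` of the `⟨T⟩`-orbits on `X = SL(2, ℤ)/Γ₀(N)` (one per cusp, `card_basePoints`). [folklore] -/
def cuspSum : (Gamma0Coset N → ℝ) →ₗ[ℝ] ({x // x ∈ basePoints N} → ℝ) where
  toFun b p := ∑ y ∈ orbitFin N p.1, b y
  map_add' b b' := by
    funext p
    simp [Finset.sum_add_distrib]
  map_smul' c b := by
    funext p
    simp [Finset.mul_sum]

/-- Unfolding `cuspSum`. [folklore] -/
@[simp] theorem cuspSum_apply (b : Gamma0Coset N → ℝ) (p : {x // x ∈ basePoints N}) :
    cuspSum N b p = ∑ y ∈ orbitFin N p.1, b y := rfl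

/-- The cusp sums are `T^*`-invariant. [folklore] -/
theorem cuspSum_coperm_T (b : Gamma0Coset N → ℝ) : cuspSum N (coperm T b) = cuspSum N b := by
  funext p
  obtain ⟨p, hp⟩ := p
  simp only [cuspSum_apply, coperm_apply]
  rw [sum_orbitFin_eq, sum_orbitFin_eq]
  simp_rw [smul_smul, ← pow_succ']
  have h := Finset.sum_range_succ' (fun i ↦ b (T ^ i • p)) (width N p)
  have h' := Finset.sum_range_succ (fun i ↦ b (T ^ i • p)) (width N p)
  rw [T_pow_width_smul] at h'
  simp only [pow_zero, one_smul] at h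
  linarith

/-- The cusp-sum map is onto `ℝ^{cusps}`. [folklore] -/
theorem cuspSum_surjective : Function.Surjective (cuspSum N) := by
  intro h
  refine ⟨fun x ↦ if hx : x ∈ basePoints N then h ⟨x, hx⟩ else 0, ?_⟩
  funext p
  obtain ⟨p, hp⟩ := p
  rw [cuspSum_apply, Finset.sum_eq_single p]
  · simp [hp]
  · intro y hy hyp
    rw [dif_neg]
    intro hyb
    have h1 : base N y = base N p := base_eq_of_mem N hy
    rw [(Finset.mem_filter.mp hyb).2, (Finset.mem_filter.mp hp).2] at h1
    exact hyp h1
  · intro hnp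
    exact absurd (self_mem_orbitFin N p) hnp

/-- `rank(cusp sums) = ν_∞`. [folklore] -/
theorem finrank_range_cuspSum : finrank ℝ (range (cuspSum N)) = (basePoints N).card := by
  rw [LinearMap.range_eq_top.mpr cuspSum_surjective, finrank_top, finrank_fintype_fun_eq_card,
    Fintype.card_coe]

/-- **`ker(1 + (ST)^* + (ST)^{*2}) + ker(cusp sums)` has codimension `≤ 1`**: it contains
`Pf - f` for `P = (ST)^*` (as `(1 + P + P²)(P - 1) = P³ - 1 = 0`) and for `P = T^*`, hence for
`P = g^*`, all `g ∈ ⟨ST, T⟩ = SL(2, ℤ)`, hence every `e_y - e_x` (`SL(2, ℤ)` is transitive on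
`X`). [folklore] -/
theorem card_le_finrank_ker_sup_add_one :
    Fintype.card (Gamma0Coset N) ≤
      finrank ℝ ↥(LinearMap.ker (relST N) ⊔ LinearMap.ker (cuspSum N)) + 1 := by
  set R : Submodule ℝ (Gamma0Coset N → ℝ) := LinearMap.ker (relST N) ⊔ LinearMap.ker (cuspSum N)
    with hR
  have hST : ∀ f : Gamma0Coset N → ℝ, coperm (S * T) f - f ∈ R := fun f ↦ by
    refine Submodule.mem_sup_left ?_
    rw [LinearMap.mem_ker]
    have h3 := congrArg (fun φ ↦ φ f) (coperm_ST_comp_ST_comp_ST (N := N))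
    simp only [LinearMap.comp_apply, LinearMap.id_apply] at h3
    simp only [relST, map_sub, LinearMap.add_apply, LinearMap.id_apply, LinearMap.comp_apply, h3]
    abel
  have hT : ∀ f : Gamma0Coset N → ℝ, coperm T f - f ∈ R := fun f ↦ by
    refine Submodule.mem_sup_right ?_
    rw [LinearMap.mem_ker, map_sub, cuspSum_coperm_T, sub_self]
  -- the subgroup of `g` with `g^* f - f ∈ R` for all `f`
  let K : Subgroup SL(2, ℤ) :=
    { carrier := {g | ∀ f : Gamma0Coset N → ℝ, coperm g f - f ∈ R}
      mul_mem' := fun {a b} ha hb f ↦ by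
        rw [coperm_mul, LinearMap.comp_apply, ← sub_add_sub_cancel _ (coperm a f) f]
        exact R.add_mem (hb _) (ha f)
      one_mem' := fun f ↦ by simp [coperm_one]
      inv_mem' := fun {a} ha f ↦ by
        have h := R.neg_mem (ha (coperm a⁻¹ f))
        rwa [coperm_coperm_inv, neg_sub] at h }
  have hTK : T ∈ K := hT
  have hSK : S ∈ K := by
    have : S = S * T * T⁻¹ := by group
    rw [this]
    exact K.mul_mem hST (K.inv_mem hTK)
  have hK : K = ⊤ := by
    rw [eq_top_iff, ← SpecialLinearGroup.SL2Z_generators, Subgroup.closure_le]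
    intro g hg
    rcases hg with rfl | rfl
    · exact hSK
    · exact hTK
  have hsingle : ∀ x y : Gamma0Coset N, Pi.single y (1 : ℝ) - Pi.single x 1 ∈ R := by
    intro x y
    obtain ⟨g, hg⟩ : ∃ g : SL(2, ℤ), g⁻¹ • x = y := by
      induction x using QuotientGroup.induction_on with
      | H a =>
        induction y using QuotientGroup.induction_on with
        | H b =>
          refine ⟨a * b⁻¹, ?_⟩
          rw [MulAction.Quotient.smul_mk, smul_eq_mul, mul_inv_rev, inv_inv, mul_assoc,
            inv_mul_cancel, mul_one]
    have h := (hK ▸ Subgroup.mem_top g : g ∈ K) (Pi.single x 1)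
    rwa [coperm_single, hg] at h
  set x₀ : Gamma0Coset N := ((1 : SL(2, ℤ)) : Gamma0Coset N)
  set L : Submodule ℝ (Gamma0Coset N → ℝ) := Submodule.span ℝ {Pi.single x₀ 1}
  have htop : (⊤ : Submodule ℝ (Gamma0Coset N → ℝ)) ≤ R ⊔ L := by
    rw [← (Pi.basisFun ℝ _).span_eq, Submodule.span_le]
    rintro _ ⟨x, rfl⟩
    rw [Pi.basisFun_apply]
    have : (Pi.single x (1 : ℝ) : Gamma0Coset N → ℝ) =
        (Pi.single x 1 - Pi.single x₀ 1) + Pi.single x₀ 1 := by abel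
    rw [this]
    exact Submodule.add_mem_sup (hsingle x₀ x) (Submodule.subset_span rfl)
  have h1 : finrank ℝ L ≤ 1 := by
    simpa using finrank_span_le_card ({Pi.single x₀ (1 : ℝ)} : Set (Gamma0Coset N → ℝ))
  have h2 := Submodule.finrank_mono htop
  rw [finrank_top, finrank_fintype_fun_eq_card] at h2
  have h3 := Submodule.finrank_add_le_finrank_add_finrank R L
  omega

/-! ### Shapiro's lemma made explicit: cocycles of `SL(2, ℤ)` in `ℝ^X` from homomorphisms of `Γ₀(N)` -/

/-- A set-theoretic section of `SL(2, ℤ) → X = SL(2, ℤ)/Γ₀(N)`. [folklore] -/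
def sec (x : Gamma0Coset N) : SL(2, ℤ) := Quotient.out x

omit [NeZero N] in
/-- `sec x` represents `x`. [folklore] -/
@[simp] theorem coe_sec (x : Gamma0Coset N) : (sec x : Gamma0Coset N) = x :=
  QuotientGroup.out_eq' x

omit [NeZero N] in
/-- `s(gx)⁻¹ g s(x) ∈ Γ₀(N)`. [folklore] -/
theorem sec_smul_inv_mul_mem (g : SL(2, ℤ)) (x : Gamma0Coset N) :
    (sec (g • x))⁻¹ * g * sec x ∈ Gamma0 N := by
  rw [mul_assoc, ← QuotientGroup.eq, coe_sec, ← smul_eq_mul, ← MulAction.Quotient.smul_mk, coe_sec]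

/-- The **transfer element** `ℓ(g, x) = s(gx)⁻¹ g s(x) ∈ Γ₀(N)` of `g ∈ SL(2, ℤ)` at `x ∈ X`.
[folklore] -/
def liftElem (g : SL(2, ℤ)) (x : Gamma0Coset N) : Gamma0 N :=
  ⟨(sec (g • x))⁻¹ * g * sec x, sec_smul_inv_mul_mem g x⟩

omit [NeZero N] in
/-- Unfolding `liftElem`. [folklore] -/
@[simp] theorem coe_liftElem (g : SL(2, ℤ)) (x : Gamma0Coset N) :
    (liftElem g x : SL(2, ℤ)) = (sec (g • x))⁻¹ * g * sec x := rfl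

omit [NeZero N] in
/-- The cocycle identity of the transfer: `ℓ(gh, x) = ℓ(g, hx) ℓ(h, x)`. [folklore] -/
theorem liftElem_mul (g h : SL(2, ℤ)) (x : Gamma0Coset N) :
    liftElem (g * h) x = liftElem g (h • x) * liftElem h x := by
  apply Subtype.ext
  simp only [coe_liftElem, Subgroup.coe_mul, mul_smul]
  group

omit [NeZero N] in
/-- `ℓ(1, x) = 1`. [folklore] -/
theorem liftElem_one (x : Gamma0Coset N) : liftElem (N := N) 1 x = 1 := by
  apply Subtype.ext
  simp

omit [NeZero N] in
/-- `ℓ(-1, x) = -1`. [folklore] -/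
theorem coe_liftElem_neg_one (x : Gamma0Coset N) :
    (liftElem (N := N) (-1) x : SL(2, ℤ)) = -1 := by
  simp [neg_one_smul_coset]

omit [NeZero N] in
/-- `γ ∈ Γ₀(N)` fixes the identity coset. [folklore] -/
theorem smul_coe_one_of_mem {γ : SL(2, ℤ)} (hγ : γ ∈ Gamma0 N) :
    γ • ((1 : SL(2, ℤ)) : Gamma0Coset N) = ((1 : SL(2, ℤ)) : Gamma0Coset N) := by
  rw [MulAction.Quotient.smul_mk, smul_eq_mul, mul_one, QuotientGroup.eq, mul_one]
  exact inv_mem hγ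

omit [NeZero N] in
/-- `s(Γ₀(N)) ∈ Γ₀(N)`. [folklore] -/
theorem sec_one_mem : sec ((1 : SL(2, ℤ)) : Gamma0Coset N) ∈ Gamma0 N := by
  have h := coe_sec ((1 : SL(2, ℤ)) : Gamma0Coset N)
  rw [QuotientGroup.eq, mul_one] at h
  exact inv_mem_iff.mp h

omit [NeZero N] in
/-- `u(1) = 0` for an additive `u : Γ₀(N) → ℝ`. [folklore] -/
theorem map_one_of_additive {u : Gamma0 N → ℝ} (hu : ∀ γ δ, u (γ * δ) = u γ + u δ) : u 1 = 0 := by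
  have h := hu 1 1
  rw [mul_one] at h
  linarith

omit [NeZero N] in
/-- `u(γ⁻¹) = -u(γ)` for an additive `u : Γ₀(N) → ℝ`. [folklore] -/
theorem map_inv_of_additive {u : Gamma0 N → ℝ} (hu : ∀ γ δ, u (γ * δ) = u γ + u δ) (γ : Gamma0 N) :
    u γ⁻¹ = -u γ := by
  have h := hu γ⁻¹ γ
  rw [inv_mul_cancel, map_one_of_additive hu] at h
  linarith

/-- The **Shapiro lift** `E_u(g) = (x ↦ u(s(gx)⁻¹ g s(x))) ∈ ℝ^X` of a function `u : Γ₀(N) → ℝ`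
at `g ∈ SL(2, ℤ)` (the explicit inverse of the Shapiro isomorphism
`H¹(SL(2, ℤ), Coind ℝ) ≅ H¹(Γ₀(N), ℝ)` on cocycles). [folklore] -/
def lift (u : Gamma0 N → ℝ) (g : SL(2, ℤ)) : Gamma0Coset N → ℝ := fun x ↦ u (liftElem g x)

omit [NeZero N] in
/-- Unfolding `lift`. [folklore] -/
@[simp] theorem lift_apply (u : Gamma0 N → ℝ) (g : SL(2, ℤ)) (x : Gamma0Coset N) :
    lift u g x = u (liftElem g x) := rfl

/-- The coboundary `δf(g) = g^* f - f` of `f ∈ ℝ^X`. [folklore] -/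
def cobd (f : Gamma0Coset N → ℝ) (g : SL(2, ℤ)) : Gamma0Coset N → ℝ := coperm g f - f

omit [NeZero N] in
/-- Coboundaries are cocycles: `δf(gh) = h^* δf(g) + δf(h)`. [folklore] -/
theorem cobd_mul (f : Gamma0Coset N → ℝ) (g h : SL(2, ℤ)) :
    cobd f (g * h) = coperm h (cobd f g) + cobd f h := by
  simp only [cobd, coperm_mul, LinearMap.comp_apply, map_sub]
  abel

omit [NeZero N] in
/-- `δf(1) = 0`. [folklore] -/
theorem cobd_one (f : Gamma0Coset N → ℝ) : cobd f 1 = 0 := by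
  simp [cobd, coperm_one]

omit [NeZero N] in
/-- `δf(-1) = 0`. [folklore] -/
theorem cobd_neg_one (f : Gamma0Coset N → ℝ) : cobd f (-1) = 0 := by
  simp [cobd, coperm_neg_one]

omit [NeZero N] in
/-- Coboundaries restrict to zero on `Γ₀(N)`: `δf(γ)(Γ₀(N)) = 0`. [folklore] -/
theorem cobd_apply_coe_one (f : Gamma0Coset N → ℝ) (γ : Gamma0 N) :
    cobd f γ ((1 : SL(2, ℤ)) : Gamma0Coset N) = 0 := by
  simp [cobd, smul_coe_one_of_mem γ.2]

/-- The cocycle `E_u + δf`. [folklore] -/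
def tot (u : Gamma0 N → ℝ) (f : Gamma0Coset N → ℝ) (g : SL(2, ℤ)) : Gamma0Coset N → ℝ :=
  lift u g + cobd f g

section Additive

variable {u : Gamma0 N → ℝ} (hu : ∀ γ δ, u (γ * δ) = u γ + u δ)
include hu

omit [NeZero N] in
/-- **The Shapiro lift of a homomorphism is a cocycle**: `E(gh) = h^* E(g) + E(h)`. [folklore] -/
theorem lift_mul (g h : SL(2, ℤ)) : lift u (g * h) = coperm h (lift u g) + lift u h := by
  funext x
  simp only [lift_apply, Pi.add_apply, coperm_apply, liftElem_mul, hu]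

omit [NeZero N] in
/-- `E(1) = 0`. [folklore] -/
theorem lift_one : lift u 1 = 0 := by
  funext x
  simp [liftElem_one, map_one_of_additive hu]

omit [NeZero N] in
/-- `E(-1) = 0` (`u(-1) = 0` as `2u(-1) = u(1) = 0`). [folklore] -/
theorem lift_neg_one : lift u (-1) = 0 := by
  funext x
  simp only [lift_apply, Pi.zero_apply]
  have hm : liftElem (N := N) (-1) x * liftElem (-1) x = 1 :=
    Subtype.ext (by simp [neg_one_smul_coset])
  have h := hu (liftElem (-1) x) (liftElem (-1) x)
  rw [hm, map_one_of_additive hu] at h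
  linarith

omit [NeZero N] in
/-- **The lift restricts to `u` on `Γ₀(N)`**: `E_u(γ)(Γ₀(N)) = u(s₀⁻¹γs₀) = u(γ)`. [folklore] -/
theorem lift_apply_coe_one (γ : Gamma0 N) : lift u γ ((1 : SL(2, ℤ)) : Gamma0Coset N) = u γ := by
  have h1 : liftElem (γ : SL(2, ℤ)) ((1 : SL(2, ℤ)) : Gamma0Coset N) =
      (⟨sec ((1 : SL(2, ℤ)) : Gamma0Coset N), sec_one_mem⟩ : Gamma0 N)⁻¹ * γ *
        ⟨sec ((1 : SL(2, ℤ)) : Gamma0Coset N), sec_one_mem⟩ :=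
    Subtype.ext (by simp [smul_coe_one_of_mem γ.2])
  rw [lift_apply, h1, hu, hu, map_inv_of_additive hu]
  ring

omit [NeZero N] in
/-- `(E_u + δf)(gh) = h^*(E_u + δf)(g) + (E_u + δf)(h)`. [folklore] -/
theorem tot_mul (f : Gamma0Coset N → ℝ) (g h : SL(2, ℤ)) :
    tot u f (g * h) = coperm h (tot u f g) + tot u f h := by
  simp only [tot, lift_mul hu, cobd_mul, map_add]
  abel

omit [NeZero N] in
/-- `(E_u + δf)(1) = 0`. [folklore] -/
theorem tot_one (f : Gamma0Coset N → ℝ) : tot u f 1 = 0 := by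
  simp [tot, lift_one hu, cobd_one]

omit [NeZero N] in
/-- `(E_u + δf)(-1) = 0`. [folklore] -/
theorem tot_neg_one (f : Gamma0Coset N → ℝ) : tot u f (-1) = 0 := by
  simp [tot, lift_neg_one hu, cobd_neg_one]

omit [NeZero N] in
/-- `(E_u + δf)(g⁻¹) = -(g⁻¹)^*(E_u + δf)(g)`. [folklore] -/
theorem tot_inv (f : Gamma0Coset N → ℝ) (g : SL(2, ℤ)) :
    tot u f g⁻¹ = -coperm g⁻¹ (tot u f g) := by
  have h := tot_mul hu f g g⁻¹
  rw [mul_inv_cancel, tot_one hu] at h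
  exact eq_neg_of_add_eq_zero_right h.symm

omit [NeZero N] in
/-- `(E_u + δf)(γ)(Γ₀(N)) = u(γ)` for `γ ∈ Γ₀(N)`. [folklore] -/
theorem tot_apply_coe_one (f : Gamma0Coset N → ℝ) (γ : Gamma0 N) :
    tot u f γ ((1 : SL(2, ℤ)) : Gamma0Coset N) = u γ := by
  simp only [tot, Pi.add_apply, lift_apply_coe_one hu, cobd_apply_coe_one, add_zero]

omit [NeZero N] in
/-- **A cocycle of `SL(2, ℤ) = ⟨S, T⟩` vanishing at `S` and `T` vanishes.** [folklore] -/
theorem tot_eq_zero_of_S_T (f : Gamma0Coset N → ℝ) (hS : tot u f S = 0) (hT : tot u f T = 0)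
    (g : SL(2, ℤ)) : tot u f g = 0 := by
  have hg : g ∈ Subgroup.closure ({S, T} : Set SL(2, ℤ)) := by
    rw [SpecialLinearGroup.SL2Z_generators]
    exact Subgroup.mem_top g
  induction hg using Subgroup.closure_induction with
  | mem x hx =>
    rcases hx with rfl | rfl
    · exact hS
    · exact hT
  | one => exact tot_one hu f
  | mul x y _ _ hx hy => rw [tot_mul hu, hx, hy, map_zero, add_zero]
  | inv x _ hx => rw [tot_inv hu, hx, map_zero, neg_zero]

omit [NeZero N] in
/-- `E_u(Tⁿ)(x) = ∑_{i<n} E_u(T)(Tⁱx)`. [folklore] -/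
theorem lift_T_pow_apply (n : ℕ) (x : Gamma0Coset N) :
    lift u (T ^ n) x = ∑ i ∈ Finset.range n, lift u T (T ^ i • x) := by
  induction n generalizing x with
  | zero => rw [pow_zero, lift_one hu]; simp
  | succ n ih =>
    rw [pow_succ, lift_mul hu, Pi.add_apply, coperm_apply, ih, Finset.sum_range_succ', pow_zero,
      one_smul]
    simp_rw [smul_smul, ← pow_succ]

end Additive

/-! ### The parabolic condition: cusp sums of `E_u(T)` vanish -/

omit [NeZero N] in
/-- `Tⁿ` is parabolic for `n ≠ 0`. [folklore] -/
theorem isParabolic_T_pow {n : ℕ} (hn : n ≠ 0) :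
    ((T ^ n : SL(2, ℤ)) : Matrix (Fin 2) (Fin 2) ℤ).IsParabolic := by
  have hT : ((T ^ n : SL(2, ℤ)) : Matrix (Fin 2) (Fin 2) ℤ) = !![1, (n : ℤ); 0, 1] := by
    rw [← zpow_natCast, coe_T_zpow]
  rw [hT, Matrix.isParabolic_iff_of_upperTriangular (by simp)]
  simp [hn]

omit [NeZero N] in
/-- Conjugates of parabolic elements are parabolic. [folklore] -/
theorem isParabolic_conj {M : SL(2, ℤ)} (hM : (M : Matrix (Fin 2) (Fin 2) ℤ).IsParabolic)
    (A : SL(2, ℤ)) : ((A⁻¹ * M * A : SL(2, ℤ)) : Matrix (Fin 2) (Fin 2) ℤ).IsParabolic := by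
  have hinv : ((A⁻¹ : SL(2, ℤ)) : Matrix (Fin 2) (Fin 2) ℤ) = (A : Matrix (Fin 2) (Fin 2) ℤ)⁻¹ := by
    rw [Matrix.inv_def, Matrix.SpecialLinearGroup.det_coe, Ring.inverse_one, one_smul,
      Matrix.SpecialLinearGroup.coe_inv]
  rw [Matrix.SpecialLinearGroup.coe_mul, Matrix.SpecialLinearGroup.coe_mul, hinv]
  exact (Matrix.isParabolic_conj'_iff (Matrix.SpecialLinearGroup.toGL A)).mpr hM

omit [NeZero N] in
/-- **`E_u(T^w)(x) = u(s(x)⁻¹ T^w s(x)) = 0` for a parabolic cocycle `u` when `T^w x = x`,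
`w ≠ 0`** (`s(x)⁻¹T^ws(x)` is parabolic). [folklore] -/
theorem lift_T_pow_apply_eq_zero (u : parabolicCocycles N) {w : ℕ} (hw : w ≠ 0)
    {x : Gamma0Coset N} (hx : T ^ w • x = x) : lift (u : Gamma0 N → ℝ) (T ^ w) x = 0 := by
  rw [lift_apply]
  apply (mem_parabolicCocycles_iff.mp u.2).2
  rw [coe_liftElem, hx]
  exact isParabolic_conj (isParabolic_T_pow hw) (sec x)

/-- **The cusp sums of `E_u(T)` vanish** for a parabolic cocycle `u`: over the orbit of a base
point `x` of width `w`, `∑_{i<w} E_u(T)(Tⁱx) = E_u(T^w)(x) = 0`. [folklore] -/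
theorem cuspSum_lift_T (u : parabolicCocycles N) : cuspSum N (lift (u : Gamma0 N → ℝ) T) = 0 := by
  funext p
  obtain ⟨p, hp⟩ := p
  rw [cuspSum_apply, Pi.zero_apply, sum_orbitFin_eq,
    ← lift_T_pow_apply (mem_parabolicCocycles_iff.mp u.2).1 (width N p) p]
  exact lift_T_pow_apply_eq_zero u (width_pos N p).ne' (T_pow_width_smul N p)

/-! ### The comparison map `u ⊕ f ↦ ((E_u + δf)(S), (E_u + δf)(T))` and its kernel -/

variable (N)

/-- `u ↦ (E_u(S), E_u(T))`. [folklore] -/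
def liftPair : parabolicCocycles N →ₗ[ℝ] (Gamma0Coset N → ℝ) × (Gamma0Coset N → ℝ) where
  toFun u := (lift (u : Gamma0 N → ℝ) S, lift (u : Gamma0 N → ℝ) T)
  map_add' u v := by
    ext x <;> simp
  map_smul' c u := by
    ext x <;> simp

/-- `f ↦ (δf(S), δf(T))`. [folklore] -/
def cobdPair : (Gamma0Coset N → ℝ) →ₗ[ℝ] (Gamma0Coset N → ℝ) × (Gamma0Coset N → ℝ) where
  toFun f := (cobd f S, cobd f T)
  map_add' f f' := by
    ext x <;> simp [cobd] <;> ring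
  map_smul' c f := by
    ext x <;> simp [cobd] <;> ring

/-- The **comparison map** `Λ(u, f) = ((E_u + δf)(S), (E_u + δf)(T))` on
`H¹_P(Γ₀(N), ℝ) ⊕ ℝ^X`. [folklore] -/
def lam : (parabolicCocycles N × (Gamma0Coset N → ℝ)) →ₗ[ℝ]
    (Gamma0Coset N → ℝ) × (Gamma0Coset N → ℝ) :=
  (liftPair N).coprod (cobdPair N)

omit [NeZero N] in
/-- Unfolding `lam`. [folklore] -/
theorem lam_apply (p : parabolicCocycles N × (Gamma0Coset N → ℝ)) :
    lam N p = (tot (p.1 : Gamma0 N → ℝ) p.2 S, tot (p.1 : Gamma0 N → ℝ) p.2 T) := rfl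

omit [NeZero N] in
/-- **The kernel of `Λ` is `0 ⊕ (constants)`**: if `(E_u + δf)(S) = (E_u + δf)(T) = 0` then
`E_u + δf = 0` on `SL(2, ℤ) = ⟨S, T⟩`, so `u(γ) = (E_u + δf)(γ)(Γ₀(N)) = 0`, and then `g^*f = f` for
all `g`, i.e. `f` is constant (`SL(2, ℤ)` is transitive on `X`). [folklore] -/
theorem ker_lam_le (p : parabolicCocycles N × (Gamma0Coset N → ℝ)) (hp : p ∈ LinearMap.ker (lam N)) :
    p.1 = 0 ∧ ∀ x, p.2 x = p.2 ((1 : SL(2, ℤ)) : Gamma0Coset N) := by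
  obtain ⟨u, f⟩ := p
  have hu := (mem_parabolicCocycles_iff.mp u.2).1
  rw [LinearMap.mem_ker, lam_apply, Prod.mk_eq_zero] at hp
  have hall := tot_eq_zero_of_S_T hu f hp.1 hp.2
  have hu0 : u = 0 := by
    apply Subtype.ext
    funext γ
    have h := tot_apply_coe_one hu f γ
    rw [hall, Pi.zero_apply] at h
    simp [← h]
  refine ⟨hu0, fun x ↦ ?_⟩
  have hcobd : ∀ g, cobd f g = 0 := fun g ↦ by
    have h := hall g
    rw [tot, hu0] at h
    have h0 : lift ((0 : parabolicCocycles N) : Gamma0 N → ℝ) g = 0 := by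
      funext y
      simp
    rwa [h0, zero_add] at h
  have hx : x = sec x • ((1 : SL(2, ℤ)) : Gamma0Coset N) := by
    rw [MulAction.Quotient.smul_mk, smul_eq_mul, mul_one, coe_sec]
  have h := congr_fun (hcobd (sec x)) ((1 : SL(2, ℤ)) : Gamma0Coset N)
  rw [cobd, Pi.sub_apply, coperm_apply, Pi.zero_apply, sub_eq_zero, ← hx] at h
  exact h

omit [NeZero N] in
/-- `dim ker Λ ≤ 1`. [folklore] -/
theorem finrank_ker_lam_le_one : finrank ℝ (LinearMap.ker (lam N)) ≤ 1 := by
  let φ : LinearMap.ker (lam N) →ₗ[ℝ] ℝ :=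
    { toFun := fun p ↦ (p : parabolicCocycles N × (Gamma0Coset N → ℝ)).2
        ((1 : SL(2, ℤ)) : Gamma0Coset N)
      map_add' := fun _ _ ↦ rfl
      map_smul' := fun _ _ ↦ rfl }
  have hφ : Function.Injective φ := by
    intro p q hpq
    obtain ⟨hp1, hp2⟩ := ker_lam_le N p.1 p.2
    obtain ⟨hq1, hq2⟩ := ker_lam_le N q.1 q.2
    apply Subtype.ext
    apply Prod.ext
    · rw [hp1, hq1]
    · funext x
      rw [hp2 x, hq2 x]
      exact hpq
  have h := LinearMap.finrank_le_finrank_of_injective hφ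
  rwa [Module.finrank_self] at h

/-! ### The three linear conditions on `((E_u + δf)(S), (E_u + δf)(T))` and their solution space -/

/-- The **solution space** `W ⊆ ℝ^X × ℝ^X` of `(1 + S^*)a = 0`,
`(1 + (ST)^* + (ST)^{*2})(T^*a + b) = 0`, `cusp sums of b = 0`. [folklore] -/
def solSpace : Submodule ℝ ((Gamma0Coset N → ℝ) × (Gamma0Coset N → ℝ)) :=
  LinearMap.ker (relS N ∘ₗ LinearMap.fst ℝ _ _) ⊓
    (LinearMap.ker (relST N ∘ₗ (coperm T ∘ₗ LinearMap.fst ℝ _ _ + LinearMap.snd ℝ _ _)) ⊓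
      LinearMap.ker (cuspSum N ∘ₗ LinearMap.snd ℝ _ _))

/-- Membership in `solSpace`. [folklore] -/
theorem mem_solSpace_iff (p : (Gamma0Coset N → ℝ) × (Gamma0Coset N → ℝ)) :
    p ∈ solSpace N ↔ relS N p.1 = 0 ∧ relST N (coperm T p.1 + p.2) = 0 ∧ cuspSum N p.2 = 0 := by
  simp [solSpace]

/-- **`Λ` lands in the solution space**: `(1 + S^*)E(S) = E(S²) = E(-1) = 0`,
`(1 + U + U²)(T^*E(S) + E(T)) = (1 + U + U²)E(ST) = E((ST)³) = E(-1) = 0`, and the cusp sums of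
`E(T) = E_u(T) + T^*f - f` vanish (`cuspSum_lift_T`, `cuspSum_coperm_T`). [folklore] -/
theorem range_lam_le : LinearMap.range (lam N) ≤ solSpace N := by
  rintro _ ⟨⟨u, f⟩, rfl⟩
  have hu := (mem_parabolicCocycles_iff.mp u.2).1
  rw [mem_solSpace_iff, lam_apply]
  refine ⟨?_, ?_, ?_⟩
  · have h := tot_mul hu f S S
    rw [S_mul_S_eq_neg_one, tot_neg_one hu] at h
    rw [relS, LinearMap.add_apply, LinearMap.id_apply, add_comm]
    exact h.symm
  · have h3 := tot_mul hu f (S * T * (S * T)) (S * T)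
    rw [ST_pow_three_eq, tot_neg_one hu, tot_mul hu f (S * T) (S * T), map_add] at h3
    change relST N (coperm T (tot (u : Gamma0 N → ℝ) f S) + tot (u : Gamma0 N → ℝ) f T) = 0
    rw [← tot_mul hu f S T, relST]
    simp only [LinearMap.add_apply, LinearMap.id_apply, LinearMap.comp_apply]
    rw [eq_comm] at h3
    convert h3 using 1
    abel
  · change cuspSum N (tot (u : Gamma0 N → ℝ) f T) = 0
    rw [tot, map_add, cuspSum_lift_T u, zero_add, cobd, map_sub, cuspSum_coperm_T, sub_self]

/-- **`dim W ≤ dim ker(1 + S^*) + dim(ker(1 + U + U²) ∩ ker(cusp sums))`**: project `W` to the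
first factor; the fibre over `a = 0` is `ker(1 + U + U²) ∩ ker(cusp sums)`. [folklore] -/
theorem finrank_solSpace_le :
    finrank ℝ (solSpace N) ≤ finrank ℝ (LinearMap.ker (relS N)) +
      finrank ℝ ↥(LinearMap.ker (relST N) ⊓ LinearMap.ker (cuspSum N)) := by
  let π : solSpace N →ₗ[ℝ] (Gamma0Coset N → ℝ) := LinearMap.fst ℝ _ _ ∘ₗ (solSpace N).subtype
  have hπ := LinearMap.finrank_range_add_finrank_ker π
  have hrange : LinearMap.range π ≤ LinearMap.ker (relS N) := by
    rintro _ ⟨p, rfl⟩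
    exact ((mem_solSpace_iff N p.1).mp p.2).1
  have h1 := Submodule.finrank_mono hrange
  let ψ : LinearMap.ker π →ₗ[ℝ] (Gamma0Coset N → ℝ) :=
    LinearMap.snd ℝ _ _ ∘ₗ (solSpace N).subtype ∘ₗ (LinearMap.ker π).subtype
  have hker : ∀ p : LinearMap.ker π,
      ((p : solSpace N) : (Gamma0Coset N → ℝ) × (Gamma0Coset N → ℝ)).1 = 0 :=
    fun p ↦ LinearMap.mem_ker.mp p.2
  have hψinj : Function.Injective ψ := by
    intro p q hpq
    apply Subtype.ext
    apply Subtype.ext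
    exact Prod.ext (by rw [hker p, hker q]) hpq
  have hψrange : LinearMap.range ψ ≤ LinearMap.ker (relST N) ⊓ LinearMap.ker (cuspSum N) := by
    rintro _ ⟨p, rfl⟩
    obtain ⟨-, h2, h3⟩ := (mem_solSpace_iff N _).mp (p : solSpace N).2
    rw [hker p, map_zero, zero_add] at h2
    exact ⟨h2, h3⟩
  have h2 := Submodule.finrank_mono hψrange
  rw [LinearMap.finrank_range_of_inj hψinj] at h2
  omega

/-! ### The count -/

/-- **`dim_ℝ H¹_P(Γ₀(N), ℝ) ≤ 2g(X₀(N))`** in the form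
`6 dim_ℝ H¹_P(Γ₀(N), ℝ) + 3ε₂ + 4ε₃ + 6ε_∞ ≤ 12 + μ` with `μ = [SL(2, ℤ) : Γ₀(N)]`,
`ε₂ = #{x ∈ SL(2, ℤ)/Γ₀(N) : Sx = x}`, `ε₃ = #{x : TSx = x}`, `ε_∞` the number of cusps of `Γ₀(N)`
(so that `2g(X₀(N)) = 2 + μ/6 - ε₂/2 - 2ε₃/3 - ε_∞`): the inequality half of Shimura's count
`dim H¹_P(Γ, X) = 2g` ((8.2.24) for `n = 0`, Prop. 8.3), here by Shapiro's lemma and linear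
algebra in `ℝ^X`: `dim H¹_P + μ ≤ dim ker Λ + dim W ≤ 1 + (μ - rk(1 + S^*)) + (μ - rk(1 + U + U²))
+ (μ - ε_∞) + 1 - μ` with `2 rk(1 + S^*) = μ + ε₂`, `3 rk(1 + U + U²) = μ + 2ε₃`.
[cite: ShimuraIATAF1971, §8.2 (8.2.24) with Prop. 8.3 (case n = 0)] -/
theorem six_mul_finrank_parabolicCocycles_le :
    6 * finrank ℝ (parabolicCocycles N) + 3 * Nat.card {q : SL(2, ℤ) ⧸ Gamma0 N // S • q = q} +
        4 * Nat.card {q : SL(2, ℤ) ⧸ Gamma0 N // (T * S) • q = q} +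
        6 * Nat.card (CuspOrbits (Gamma0 N : Subgroup (GL (Fin 2) ℝ))) ≤
      12 + (Gamma0 N).index := by
  -- notation and the numerical inputs
  have hμ : (Gamma0 N).index = Fintype.card (Gamma0Coset N) := by
    rw [Subgroup.index, Nat.card_eq_fintype_card]
  have hε₂ : Nat.card {q : SL(2, ℤ) ⧸ Gamma0 N // S • q = q} =
      (Finset.univ.filter fun q : Gamma0Coset N ↦ S • q = q).card := by
    rw [Nat.card_eq_fintype_card, Fintype.card_subtype]
  have hε₃ : Nat.card {q : SL(2, ℤ) ⧸ Gamma0 N // (T * S) • q = q} =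
      (Finset.univ.filter fun q : Gamma0Coset N ↦ (S * T) • q = q).card := by
    rw [card_fixed_TS_eq_card_fixed_ST, Nat.card_eq_fintype_card, Fintype.card_subtype]
  have hε : Nat.card (CuspOrbits (Gamma0 N : Subgroup (GL (Fin 2) ℝ))) = (basePoints N).card := by
    rw [card_basePoints, ← numCusps_eq_nuInfty_holds N, numCusps]
  have hS := two_mul_finrank_range_relS (N := N)
  have hST := three_mul_finrank_range_relST (N := N)
  have hC := finrank_range_cuspSum (N := N)
  -- rank–nullity for the three operators
  have hS' := LinearMap.finrank_range_add_finrank_ker (relS N)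
  have hST' := LinearMap.finrank_range_add_finrank_ker (relST N)
  have hC' := LinearMap.finrank_range_add_finrank_ker (cuspSum N)
  rw [finrank_fintype_fun_eq_card] at hS' hST' hC'
  -- `dim (ker U ∩ ker C) + μ ≤ dim ker U + dim ker C + 1`
  have hsup := Submodule.finrank_sup_add_finrank_inf_eq (LinearMap.ker (relST N))
    (LinearMap.ker (cuspSum N))
  have hcodim := card_le_finrank_ker_sup_add_one (N := N)
  -- `dim H¹_P + μ = dim ker Λ + dim range Λ ≤ 1 + dim W`
  have hΛ := LinearMap.finrank_range_add_finrank_ker (lam N)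
  rw [Module.finrank_prod, finrank_fintype_fun_eq_card] at hΛ
  have hker := finrank_ker_lam_le_one N
  have hrange := Submodule.finrank_mono (range_lam_le N)
  have hW := finrank_solSpace_le N
  rw [hμ, hε₂, hε₃, hε]
  omega

end ParabolicCount

/-! ### The degenerate level `N = 0`: `Γ₀(0) = {±Tʲ}` -/

namespace LevelZero

open _root_.Module UpperHalfPlane Filter OnePoint Function
open scoped Topology Manifold Real

/-- Elements of `Γ₀(0)` are upper triangular. [folklore] -/
theorem apply_one_zero_eq_zero {γ : SL(2, ℤ)} (hγ : γ ∈ Gamma0 0) : γ 1 0 = 0 := by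
  have h := Gamma0_mem.mp hγ
  exact h

/-- `Γ₀(0) = {±Tʲ : j ∈ ℤ}`. [folklore] -/
theorem exists_eq_T_zpow_or {γ : SL(2, ℤ)} (hγ : γ ∈ Gamma0 0) : ∃ j : ℤ, γ = T ^ j ∨ γ = -T ^ j :=
  exists_eq_T_zpow_or_of_apply_one_zero (apply_one_zero_eq_zero hγ)

/-- **`H¹_P(Γ₀(0), ℝ) = 0`**: every element of `Γ₀(0) = {±Tʲ}` is `±1` or parabolic, so a
parabolic cocycle vanishes identically (`u(-1) = 0` as `2u(-1) = u(1) = 0`). [folklore] -/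
theorem parabolicCocycles_zero_eq_bot : parabolicCocycles 0 = ⊥ := by
  rw [eq_bot_iff]
  intro u hu
  obtain ⟨hadd, hpar⟩ := mem_parabolicCocycles_iff.mp hu
  rw [Submodule.mem_bot]
  funext γ
  rw [Pi.zero_apply]
  have h1 : u 1 = 0 := by
    have h := hadd 1 1
    rw [mul_one] at h
    linarith
  obtain ⟨j, hj⟩ := exists_eq_T_zpow_or γ.2
  by_cases hj0 : j = 0
  · subst hj0
    rw [zpow_zero] at hj
    rcases hj with h | h
    · have : γ = 1 := Subtype.ext h
      rw [this, h1]
    · have hsq : γ * γ = 1 := Subtype.ext (by simp [h])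
      have h2 := hadd γ γ
      rw [hsq, h1] at h2
      linarith
  · apply hpar
    have hT : ((T ^ j : SL(2, ℤ)) : Matrix (Fin 2) (Fin 2) ℤ).IsParabolic := by
      rw [coe_T_zpow, Matrix.isParabolic_iff_of_upperTriangular (by simp)]
      simp [hj0]
    rcases hj with h | h
    · rw [h]
      exact hT
    · rw [h, Matrix.SpecialLinearGroup.coe_neg]
      exact hT.neg

/-- The only cusp of `Γ₀(0) = {±Tʲ}` is `∞` (the fixed point of its parabolic elements). [folklore] -/
theorem eq_infty_of_isCusp {c : OnePoint ℝ}
    (hc : IsCusp c ((Gamma0 0 : Subgroup SL(2, ℤ)) : Subgroup (GL (Fin 2) ℝ))) : c = ∞ := by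
  obtain ⟨_, ⟨γ, hγ, rfl⟩, hpar, hfix⟩ := hc
  have h10 : (Matrix.SpecialLinearGroup.mapGL ℝ γ : GL (Fin 2) ℝ) 1 0 = 0 := by
    simp [apply_one_zero_eq_zero hγ]
  have hinf : (Matrix.SpecialLinearGroup.mapGL ℝ γ : GL (Fin 2) ℝ) • (∞ : OnePoint ℝ) = ∞ :=
    smul_infty_eq_self_iff.mpr h10
  rw [hpar.smul_eq_self_iff] at hfix hinf
  rw [hfix, ← hinf]

/-- `q(Tʲτ) = q(τ)` for `q = e^{2πiτ}`. [folklore] -/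
theorem qParam_T_zpow_smul (j : ℤ) (τ : ℍ) :
    Periodic.qParam 1 (((T ^ j • τ : ℍ)) : ℂ) = Periodic.qParam 1 (τ : ℂ) := by
  rw [UpperHalfPlane.modular_T_zpow_smul, UpperHalfPlane.coe_vadd]
  simp only [Periodic.qParam, Complex.ofReal_one, div_one, Complex.ofReal_intCast]
  rw [mul_add, Complex.exp_add]
  have : Complex.exp (2 * π * Complex.I * (j : ℂ)) = 1 := by
    rw [show (2 * π * Complex.I * (j : ℂ)) = (j : ℂ) * (2 * π * Complex.I) by ring]
    exact Complex.exp_int_mul_two_pi_mul_I j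
  rw [this, one_mul]

/-- **Weight-`2` invariance of `q^{m+1}` under `Γ₀(0) = {±Tʲ}`** (`q` is `1`-periodic and
`(-1)² = 1`). [folklore] -/
theorem qPow_slash_eq (m : ℕ) {γ : SL(2, ℤ)} (hγ : γ ∈ Gamma0 0) :
    (fun τ : ℍ ↦ Periodic.qParam 1 (τ : ℂ) ^ (m + 1)) ∣[(2 : ℤ)] γ =
      fun τ : ℍ ↦ Periodic.qParam 1 (τ : ℂ) ^ (m + 1) := by
  funext τ
  rw [ModularForm.slash_action_eq'_iff]
  obtain ⟨j, hj⟩ := exists_eq_T_zpow_or hγ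
  rcases hj with rfl | rfl
  · rw [qParam_T_zpow_smul]
    simp [coe_T_zpow]
  · rw [ModularGroup.SL_neg_smul, qParam_T_zpow_smul]
    simp [coe_T_zpow]
    norm_num

/-- **The cusp forms `q^{m+1} = e^{2πi(m+1)τ} ∈ S₂(Γ₀(0))`**, `m ≥ 0`: `1`-periodic, invariant under
`-1` in weight `2`, holomorphic, and vanishing at the only cusp `∞`. [folklore] -/
def qPowCuspForm (m : ℕ) : CuspForm (Gamma0 0) 2 where
  toFun τ := Periodic.qParam 1 (τ : ℂ) ^ (m + 1)
  slash_action_eq' := by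
    rintro _ ⟨γ, hγ, rfl⟩
    exact qPow_slash_eq m hγ
  holo' := by
    show MDifferentiable 𝓘(ℂ) 𝓘(ℂ) (fun τ : ℍ ↦ Periodic.qParam 1 (τ : ℂ) ^ (m + 1))
    intro τ
    rw [UpperHalfPlane.mdifferentiableAt_iff]
    have : (fun σ : ℍ ↦ Periodic.qParam 1 (σ : ℂ) ^ (m + 1)) ∘ ofComplex =ᶠ[𝓝 (τ : ℂ)]
        fun z ↦ Periodic.qParam 1 z ^ (m + 1) := by
      filter_upwards [isOpen_upperHalfPlaneSet.mem_nhds τ.im_pos] with z hz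
      simp [ofComplex_apply_of_im_pos hz]
    refine DifferentiableAt.congr_of_eventuallyEq ?_ this
    exact ((Periodic.differentiable_qParam (h := 1)).pow (m + 1)).differentiableAt
  zero_at_cusps' := by
    intro c hc
    rw [eq_infty_of_isCusp hc, OnePoint.isZeroAt_infty_iff]
    show Tendsto (fun τ : ℍ ↦ Periodic.qParam 1 (τ : ℂ) ^ (m + 1)) atImInfty (𝓝 0)
    have h := (UpperHalfPlane.qParam_tendsto_atImInfty one_pos).pow (m + 1)
    rwa [zero_pow (Nat.succ_ne_zero m)] at h

/-- Unfolding `qPowCuspForm`. [folklore] -/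
@[simp] theorem qPowCuspForm_apply (m : ℕ) (τ : ℍ) :
    qPowCuspForm m τ = Periodic.qParam 1 (τ : ℂ) ^ (m + 1) := rfl

/-- Evaluation of a linear combination of the `q^{m+1}`. [folklore] -/
theorem sum_smul_qPowCuspForm_apply {ι : Type*} (s : Finset ι) (c : ι → ℂ) (e : ι → ℕ) (τ : ℍ) :
    (∑ i ∈ s, c i • qPowCuspForm (e i)) τ = ∑ i ∈ s, c i * Periodic.qParam 1 (τ : ℂ) ^ (e i + 1) := by
  classical
  induction s using Finset.induction_on with
  | empty => simp
  | insert a s ha ih =>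
    rw [Finset.sum_insert ha, Finset.sum_insert ha, CuspForm.add_apply, ih, CuspForm.IsGLPos.smul_apply,
      smul_eq_mul, qPowCuspForm_apply]

/-- The points `i(n+1) ∈ ℍ`. [folklore] -/
def imagAxisPt (n : ℕ) : ℍ :=
  ⟨Complex.I * ((n : ℂ) + 1), by simpa [Complex.mul_im] using Nat.cast_add_one_pos n⟩

/-- `q(i(n+1)) = e^{-2π(n+1)}`. [folklore] -/
theorem qParam_imagAxisPt (n : ℕ) :
    Periodic.qParam 1 ((imagAxisPt n : ℍ) : ℂ) = ((Real.exp (-(2 * π * ((n : ℝ) + 1))) : ℝ) : ℂ) := by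
  rw [Complex.ofReal_exp, Periodic.qParam]
  congr 1
  have hc : ((imagAxisPt n : ℍ) : ℂ) = Complex.I * ((n : ℂ) + 1) := rfl
  rw [hc]
  push_cast
  linear_combination (2 * (π : ℂ) * ((n : ℂ) + 1)) * Complex.I_mul_I

/-- The values `q(i(n+1))`, `n ∈ ℕ`, are pairwise distinct. [folklore] -/
theorem qParam_imagAxisPt_injective : Function.Injective fun n : ℕ ↦ Periodic.qParam 1 ((imagAxisPt n : ℍ) : ℂ) := by
  intro a b hab
  simp only [qParam_imagAxisPt, Complex.ofReal_inj] at hab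
  have h := Real.exp_injective hab
  have h' : 2 * π * ((a : ℝ) + 1) = 2 * π * ((b : ℝ) + 1) := by linarith
  have h'' := mul_left_cancel₀ (by positivity : (2 * π : ℝ) ≠ 0) h'
  have : (a : ℝ) = b := by linarith
  exact_mod_cast this

/-- **`S₂(Γ₀(0))` is infinite-dimensional**: the cusp forms `q, q², …, q^{d+1}` are linearly
independent (a vanishing linear combination is a polynomial in `q` vanishing at the infinitely
many values `q(i(n+1))`), so `dim ≥ d + 1` for every `d`. Hence Lean's `finrank` (which is `0` for
spaces that are not finite-dimensional) vanishes. [folklore] -/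
theorem finrank_cuspForm_gamma0_zero : finrank ℂ (CuspForm (Gamma0 0) 2) = 0 := by
  apply finrank_of_not_finite
  intro hfin
  set d := finrank ℂ (CuspForm (Gamma0 0) 2) with hd
  have hli : LinearIndependent ℂ (fun i : Fin (d + 1) ↦ qPowCuspForm (i : ℕ)) := by
    rw [Fintype.linearIndependent_iff]
    intro c hc i
    set P : Polynomial ℂ := ∑ j : Fin (d + 1), Polynomial.C (c j) * Polynomial.X ^ ((j : ℕ) + 1)
      with hP
    have heval : ∀ τ : ℍ, P.eval (Periodic.qParam 1 (τ : ℂ)) = 0 := fun τ ↦ by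
      have h := congrArg (fun f : CuspForm (Gamma0 0) 2 ↦ f τ) hc
      simp only [CuspForm.zero_apply] at h
      rw [sum_smul_qPowCuspForm_apply] at h
      rw [hP, Polynomial.eval_finsetSum]
      simpa [Polynomial.eval_mul, Polynomial.eval_C, Polynomial.eval_pow, Polynomial.eval_X] using h
    have hroots : Set.Infinite {x : ℂ | P.IsRoot x} :=
      Set.infinite_of_injective_forall_mem qParam_imagAxisPt_injective fun n ↦ heval (imagAxisPt n)
    have hP0 : P = 0 := Polynomial.eq_zero_of_infinite_isRoot P hroots
    have hcoeff : P.coeff ((i : ℕ) + 1) = c i := by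
      rw [hP, Polynomial.finsetSum_coeff]
      simp only [Polynomial.coeff_C_mul, Polynomial.coeff_X_pow]
      rw [Finset.sum_eq_single i]
      · simp
      · intro j _ hji
        rw [if_neg, mul_zero]
        intro h
        exact hji (Fin.ext (by omega))
      · intro hi
        exact absurd (Finset.mem_univ i) hi
    rw [hP0, Polynomial.coeff_zero] at hcoeff
    exact hcoeff.symm
  have h := hli.fintype_card_le_finrank
  rw [Fintype.card_fin, ← hd] at h
  omega

/-- **The named fact at the degenerate level `N = 0`**: both sides vanish —
`H¹_P(Γ₀(0), ℝ) = 0` (`parabolicCocycles_zero_eq_bot`) and `finrank ℂ S₂(Γ₀(0)) = 0`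
(`finrank_cuspForm_gamma0_zero`: the space is infinite-dimensional). `Γ₀(0) = {±Tʲ}` has
infinite index and is not a Fuchsian group of the first kind, so this case lies outside the
hypotheses of Shimura's (8.2.23); it holds by the conventions of `Module.finrank`. [folklore] -/
theorem finrank_parabolicCocycles_eq_zero : finrank_parabolicCocycles_eq 0 := by
  show finrank ℝ (parabolicCocycles 0) = 2 * finrank ℂ (CuspForm (Gamma0 0) 2)
  rw [parabolicCocycles_zero_eq_bot, finrank_bot, finrank_cuspForm_gamma0_zero]

end LevelZero

/-! ### Discharge of `finrank_parabolicCocycles_eq` -/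

section Discharge

variable (N : ℕ)

/-- **`dim_ℝ H¹_P(Γ₀(N), ℝ) ≤ 2 dim_ℂ S₂(Γ₀(N))`** for `N ≥ 1`: the group-cohomological bound
`6 dim H¹_P + 3ε₂ + 4ε₃ + 6ε_∞ ≤ 12 + μ` (`ParabolicCount.six_mul_finrank_parabolicCocycles_le`,
Shimura (8.2.24)) against the dimension formula `12 dim S₂(Γ₀(N)) + 3ε₂ + 4ε₃ + 6ε_∞ = 12 + μ`
(`twelve_mul_finrank_cuspForm_two_gamma0_holds`, Shimura Thm. 2.24 / Diamond–Shurman Thm. 3.5.1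
with Thm. 3.1.1). [cite: ShimuraIATAF1971, §8.2 (8.2.23)–(8.2.24)] -/
theorem finrank_parabolicCocycles_le_two_mul_finrank [NeZero N] :
    Module.finrank ℝ (parabolicCocycles N) ≤ 2 * Module.finrank ℂ (CuspForm (Gamma0 N) 2) := by
  have h₁ := ParabolicCount.six_mul_finrank_parabolicCocycles_le N
  have h₂ := twelve_mul_finrank_cuspForm_two_gamma0_holds N (Gamma0_is_congruence N)
  rw [adjoinNegI_gamma0, ellipticPointCount_two_gamma0_eq_card,
    ellipticPointCount_three_gamma0_eq_card] at h₂
  omega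

/-- **Shimura's dimension count `dim_ℝ H¹_P(Γ₀(N), ℝ) = 2 dim_ℂ S₂(Γ₀(N))`** (Shimura 1971, §8.2,
(8.2.23), the case `n = 0`, `Ψ` trivial, `Γ = Γ₀(N)`), for every `N : ℕ`: discharges the named fact
`finrank_parabolicCocycles_eq N` of `ModularSymbolsParabolicCohomology` literally (the fact is
registered without a `NeZero N` hypothesis). For `N ≥ 1` the inequality `≥` is the injectivity of
`φ : S₂(Γ₀(N)) → H¹_P(Γ₀(N), ℝ)` (`two_mul_finrank_le_finrank_parabolicCocycles`, Thm. 8.4) and `≤`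
is `finrank_parabolicCocycles_le_two_mul_finrank` ((8.2.24): `dim H¹_P(Γ, ℝ) = 2g`, with
`dim S₂(Γ₀(N)) = g(X₀(N))`); the degenerate level `N = 0` (`Γ₀(0) = {±Tʲ}`, outside Shimura's
hypotheses) is `LevelZero.finrank_parabolicCocycles_eq_zero` (both sides are `0`).
[cite: ShimuraIATAF1971, §8.2 (8.2.23) (case n = 0, Ψ trivial, Γ = Γ₀(N))] -/
theorem finrank_parabolicCocycles_eq_holds : finrank_parabolicCocycles_eq N := by
  rcases Nat.eq_zero_or_pos N with rfl | hN
  · exact LevelZero.finrank_parabolicCocycles_eq_zero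
  · haveI : NeZero N := ⟨hN.ne'⟩
    exact le_antisymm (finrank_parabolicCocycles_le_two_mul_finrank N)
      (two_mul_finrank_le_finrank_parabolicCocycles N)

end Discharge

end Literature.NumberTheory.EllipticCurves.ModularForms
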